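import Summits.CriticalPhenomena.PercolationContinuityZ3.Theorems.PercNearOneGluingNoHeavyQuantCombMoveTop
import Summits.CriticalPhenomena.PercolationContinuityZ3.Theorems.PercNearOneGluingNoHeavyQuantCombSpliceShape
import Summits.CriticalPhenomena.PercolationContinuityZ3.Theorems.PercNearOneGluingNoHeavyQuantCombSeriesSplit
import HarnessLib

/-!
# QUANT lane R8 — the cost of splicing a hair into the spine of a comb (the SPLICE endpoint of the relocation lemma)

builds on p205010 (kernel theorem, internal audit signed; external expert review pending)

Support file (`--supports stmt-CriticalPhenomena-4575`), QUANT lane lead (gen 9), rung R8 of `run/shared/lean/prim/quant/LADDER.md`;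
memo `prim-quant-lead-g9/LEAD-NOTES-G9.md` N20 step (4) — eighth file of the kernel proof of FAR (`Quant.FarTreeRow`) at EVERY layer on
COMBS.  Setting of `…QuantCombSpliceShape.lean`: the hair `b` is spliced into the spine between level `m` and the gate `s` of rank `m+1`
(`P' b = S m ∪ {b}`, prefixes containing `s` gain `b`, `q' s · q' b = q s`, `q' = q` elsewhere).  Theorems only; no sorries.

* `Quant.comb_splice_light_eq` — **the cost of the splice endpoint**:
  `P_{q'}(#{z ∈ A | P' z open} ≤ j) = P_q(#{z ∈ A ∖ b | P z open} ≤ j) − e_{m+1} − (q' b·π_m − π_{m+1})·a_m`,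
  where `e_{m+1}`, `a_m`, `π` are the tail, level-law and prefix products of the configuration WITHOUT `b` (`…QuantCombTails.lean`).
  Proof: the light event of `A ∖ b` and the part of `{count = j, b reached}` on `{s open}` are series-split images of un-primed events
  (`Quant.prodBernoulli_real_seriesSplit`); the part on `{s closed}` factors into the level-`m` private count, the level-`m` spine prefix and
  the two gates `s`, `b`.
[this work]
-/

noncomputable section

namespace Summit.CriticalPhenomena.PercolationContinuityZ3.Theorems

namespace Quant

open Finset MeasureTheory
open Literature.Probability.LatticeModels
open Literature.Probability.Percolation
open scoped Classical

variable {ι : Type*} [Fintype ι]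

/-- **The cost of the splice endpoint** (see the module docstring). [this work] -/
theorem comb_splice_light_eq (q q' : ι → unitInterval) (P P' : ι → Finset ι) (a : ι) (A : Finset ι) (j : ℕ) {b s : ι} {m : ℕ}
    (hsp : ∀ y ∈ P a, y ∈ P y ∧ P y ⊆ P a ∧ ∀ y' ∈ P a,
      (y ∈ P y' ∨ y' ∈ P y) ∧ (y ∈ P y' → P y ⊆ P y') ∧ (y ∈ P y' → y' ∈ P y → y = y'))
    (hA5 : ∀ z ∈ A, ∀ y ∈ P z, y ∈ P a → P y ⊆ P z)
    (hA6 : ∀ z ∈ A, ∀ z' ∈ A, z ≠ z' → Disjoint (P z \ P a) (P z' \ P a))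
    (hbA : b ∈ A) (hba : b ∉ P a) (hbb : b ∈ P b) (hs : s ∈ P a) (hsm : (P s).card = m + 1)
    (hP'b : P' b = insert b ((P a).filter fun y => (P y).card ≤ m))
    (hP'1 : ∀ x, x ≠ b → s ∈ P x → P' x = insert b (P x)) (hP'2 : ∀ x, x ≠ b → s ∉ P x → P' x = P x)
    (hq' : ∀ i, i ≠ b → i ≠ s → q' i = q i) (hq'sb : (q' s : ℝ) * q' b = q s) :
    (prodBernoulli q').real {ω : Set ι | (A.filter fun z => ((P' z : Finset ι) : Set ι) ⊆ ω).card ≤ j} =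
      (prodBernoulli q).real {ω : Set ι | ((A.erase b).filter fun z => ((P z : Finset ι) : Set ι) ⊆ ω).card ≤ j} -
        ((prodBernoulli q).real {ω : Set ι | ((A.erase b).filter fun z => ((P z : Finset ι) : Set ι) ⊆ ω).card = j ∧
            (((P a).filter (fun y => (P y).card ≤ m + 1) : Finset ι) : Set ι) ⊆ ω} +
          ((q' b : ℝ) * (∏ y ∈ (P a).filter (fun y => (P y).card ≤ m), (q y : ℝ)) -
              ∏ y ∈ (P a).filter (fun y => (P y).card ≤ m + 1), (q y : ℝ)) *
            (prodBernoulli q).real {ω : Set ι |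
              (((A.erase b).filter fun z => (P z ∩ P a).card ≤ m).filter
                fun z => (((P z \ P a) : Finset ι) : Set ι) ⊆ ω).card = j}) := by
  set μ := prodBernoulli q with hμ
  set μ' := prodBernoulli q' with hμ'
  have hmeas : ∀ T : Set (Set ι), MeasurableSet T := fun T => (Set.toFinite T).measurableSet
  set A' : Finset ι := A.erase b with hA'
  set Sm : Finset ι := (P a).filter (fun y => (P y).card ≤ m) with hSm
  set Sm1 : Finset ι := (P a).filter (fun y => (P y).card ≤ m + 1) with hSm1
  have hsb : s ≠ b := fun h => hba (h ▸ hs)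
  obtain ⟨hsSm1, hsSm, hPs⟩ := comb_spine_gate_of_rank P a hsp hs hsm
  have hSm1eq : Sm1 = Sm ∪ {s} := comb_level_succ_eq P a hsp hsSm1 hsSm
  have hbSm : b ∉ Sm := fun h => hba (Finset.mem_filter.1 h).1
  have hbz : ∀ {z : ι}, z ∈ A' → b ∉ P z := fun hz =>
    comb_hair_tip_notMem P a A hbA hba hbb hA6 (Finset.mem_of_mem_erase hz) (Finset.ne_of_mem_erase hz)
  have hA5' : ∀ z ∈ A', ∀ y ∈ P z, y ∈ P a → P y ⊆ P z := fun z hz => hA5 z (Finset.mem_of_mem_erase hz)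
  -- how primed prefixes of the other relays read
  have hread_open : ∀ {z : ι} (ω : Set ι), z ∈ A' → b ∈ ω → (((P' z : Finset ι) : Set ι) ⊆ ω ↔ ((P z : Finset ι) : Set ι) ⊆ ω) := by
    intro z ω hz hbω
    have hzb : z ≠ b := Finset.ne_of_mem_erase hz
    by_cases hsz : s ∈ P z
    · rw [hP'1 z hzb hsz, Finset.coe_insert, Set.insert_subset_iff]; exact ⟨fun h => h.2, fun h => ⟨hbω, h⟩⟩
    · rw [hP'2 z hzb hsz]
  have hread_closed : ∀ {z : ι} (ω : Set ι), z ∈ A' → b ∉ ω →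
      (((P' z : Finset ι) : Set ι) ⊆ ω ↔ ((P z : Finset ι) : Set ι) ⊆ ω \ {s}) := by
    intro z ω hz hbω
    have hzb : z ≠ b := Finset.ne_of_mem_erase hz
    by_cases hsz : s ∈ P z
    · rw [hP'1 z hzb hsz, Finset.coe_insert, Set.insert_subset_iff]
      constructor
      · rintro ⟨h, -⟩; exact absurd h hbω
      · intro h; exact absurd (h (Finset.mem_coe.2 hsz)).2 (fun hn => hn rfl)
    · rw [hP'2 z hzb hsz]
      constructor
      · intro h y hy; exact ⟨h hy, fun hys => hsz (by rw [Set.mem_singleton_iff.1 hys] at hy; exact Finset.mem_coe.1 hy)⟩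
      · intro h y hy; exact (h hy).1
  -- the series-split reading of an un-primed event of the other relays
  have hSS_set : ∀ Φ : ℕ → Prop, {ω : Set ι | Φ ((A'.filter fun z => ((P' z : Finset ι) : Set ι) ⊆ ω).card)} =
      {ω : Set ι | (if b ∈ ω then ω else ω \ {s}) ∈ {ω' : Set ι | Φ ((A'.filter fun z => ((P z : Finset ι) : Set ι) ⊆ ω').card)}} := by
    intro Φ; ext ω
    simp only [Set.mem_setOf_eq]
    by_cases hbω : b ∈ ω
    · rw [if_pos hbω, Finset.filter_congr fun z hz => hread_open ω hz hbω]
    · rw [if_neg hbω, Finset.filter_congr fun z hz => hread_closed ω hz hbω]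
  -- supports: the un-primed events of `A'` ignore `b`
  set G : Finset ι := A'.biUnion P ∪ P a with hG
  have hbG : b ∉ G := by
    rw [hG, Finset.mem_union, Finset.mem_biUnion, not_or]
    exact ⟨fun ⟨z, hz, hbz'⟩ => hbz hz hbz', hba⟩
  have hGu : (↑G : Set ι) ⊆ ↑(univ.erase b) := fun i hi => by
    simp only [Finset.coe_erase, Finset.coe_univ, Set.mem_sdiff, Set.mem_univ, Set.mem_singleton_iff, true_and]
    exact fun h => hbG (h ▸ Finset.mem_coe.1 hi)
  have dC : ∀ Φ : ℕ → Prop, DeterminedBy {ω : Set ι | Φ ((A'.filter fun z => ((P z : Finset ι) : Set ι) ⊆ ω).card)} (↑G : Set ι) :=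
    fun Φ => (determinedBy_card_filter_open A' P (A'.biUnion P) (fun z hz => Finset.subset_biUnion_of_mem P hz) Φ).mono
      (by rw [hG]; exact Finset.coe_subset.2 Finset.subset_union_left)
  have dS : ∀ S : Finset ι, S ⊆ P a → DeterminedBy {ω : Set ι | ((S : Finset ι) : Set ι) ⊆ ω} (↑G : Set ι) := fun S hS =>
    (determinedBy_subset_open S).mono (Finset.coe_subset.2 (hS.trans (by rw [hG]; exact Finset.subset_union_right)))
  have hoff : ∀ i, i ≠ s → i ≠ b → q' i = q i := fun i h1 h2 => hq' i h2 h1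
  -- Term 1: the light event of `A'`
  have hT1 : μ'.real {ω : Set ι | (A'.filter fun z => ((P' z : Finset ι) : Set ι) ⊆ ω).card ≤ j} =
      μ.real {ω : Set ι | (A'.filter fun z => ((P z : Finset ι) : Set ι) ⊆ ω).card ≤ j} := by
    rw [hSS_set (fun c => c ≤ j)]
    exact prodBernoulli_real_seriesSplit q q' hsb _ ((dC fun c => c ≤ j).mono hGu) hoff hq'sb
  -- the decomposition of the light event of `A`
  set L' : Set (Set ι) := {ω | (A'.filter fun z => ((P' z : Finset ι) : Set ι) ⊆ ω).card ≤ j} with hL'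
  set PartA : Set (Set ι) := {ω | (if b ∈ ω then ω else ω \ {s}) ∈
      {ω' : Set ι | (A'.filter fun z => ((P z : Finset ι) : Set ι) ⊆ ω').card = j ∧ ((Sm1 : Finset ι) : Set ι) ⊆ ω'}} with hPartA
  set D : Set (Set ι) := {ω | ((A'.filter fun z => (P z ∩ P a).card ≤ m).filter
      fun z => (((P z \ P a) : Finset ι) : Set ι) ⊆ ω).card = j} with hD
  set Om : Set (Set ι) := {ω | ((Sm : Finset ι) : Set ι) ⊆ ω} with hOm
  set PartB : Set (Set ι) := ((D ∩ Om) ∩ {ω | s ∉ ω}) ∩ {ω | b ∈ ω} with hPartB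
  have hAe : insert b A' = A := Finset.insert_erase hbA
  have hlight : {ω : Set ι | (A.filter fun z => ((P' z : Finset ι) : Set ι) ⊆ ω).card ≤ j} = L' \ (PartA ∪ PartB) := by
    ext ω
    rw [← hAe]
    simp only [Set.mem_setOf_eq, Set.mem_sdiff, Set.mem_union, hL', hPartA, hPartB, hD, hOm, Set.mem_inter_iff]
    rw [indepEvents_card_filter_insert P' A' (Finset.notMem_erase b A) ω, hP'b, Finset.coe_insert, Set.insert_subset_iff]
    by_cases hbω : b ∈ ω
    · simp only [hbω, true_and, if_true, and_true]
      rw [Finset.filter_congr fun z hz => hread_open ω hz hbω]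
      by_cases hsω : s ∈ ω
      · have hnot : ¬ (s ∉ ω) := fun h => h hsω
        simp only [hnot, and_false, or_false]
        rw [hSm1eq, Finset.coe_union, Finset.coe_singleton, Set.union_subset_iff, Set.singleton_subset_iff]
        by_cases hO : ((Sm : Finset ι) : Set ι) ⊆ ω
        · simp only [hO, hsω, and_true, if_true]; omega
        · simp only [hO, if_false, add_zero, false_and, and_false, not_false_eq_true, and_true]
      · simp only [hsω, not_false_eq_true, and_true]
        have hO1 : ¬ ((Sm1 : Finset ι) : Set ι) ⊆ ω := fun h => hsω (h (Finset.mem_coe.2 hsSm1))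
        simp only [hO1, and_false, false_or]
        by_cases hO : ((Sm : Finset ι) : Set ι) ⊆ ω
        · simp only [hO, if_true, and_true]
          rw [comb_count_eq_on_levelCut P a A' hsp hA5' m ω hO hO1]
          omega
        · simp only [hO, if_false, add_zero, and_false, not_false_eq_true, and_true]
    · simp only [hbω, false_and, and_false, if_false, add_zero, or_false]
      have hO1 : ¬ ((Sm1 : Finset ι) : Set ι) ⊆ ω \ {s} := fun h => (h (Finset.mem_coe.2 hsSm1)).2 rfl
      simp only [hO1, and_false, not_false_eq_true, and_true]
  have hsubL : PartA ∪ PartB ⊆ L' := by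
    intro ω hω
    simp only [hL', hPartA, hPartB, hD, hOm, Set.mem_setOf_eq, Set.mem_union, Set.mem_inter_iff] at hω ⊢
    rcases hω with hω | ⟨⟨⟨hd, hO⟩, hsω⟩, hbω⟩
    · by_cases hbω : b ∈ ω
      · rw [if_pos hbω] at hω
        rw [Finset.filter_congr fun z hz => hread_open ω hz hbω]; exact hω.1.le
      · rw [if_neg hbω] at hω
        exact absurd (hω.2 (Finset.mem_coe.2 hsSm1)).2 (fun hn => hn rfl)
    · have hO1 : ¬ ((Sm1 : Finset ι) : Set ι) ⊆ ω := fun h => hsω (h (Finset.mem_coe.2 hsSm1))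
      rw [Finset.filter_congr fun z hz => hread_open ω hz hbω, comb_count_eq_on_levelCut P a A' hsp hA5' m ω hO hO1]
      exact hd.le
  have hdisjAB : Disjoint PartA PartB := by
    rw [Set.disjoint_left]
    intro ω hA hB
    simp only [hPartA, hPartB, Set.mem_setOf_eq, Set.mem_inter_iff] at hA hB
    rw [if_pos hB.2] at hA
    exact hB.1.2 (hA.2 (Finset.mem_coe.2 hsSm1))
  -- Term A
  have hTA : μ'.real PartA = μ.real {ω : Set ι | (A'.filter fun z => ((P z : Finset ι) : Set ι) ⊆ ω).card = j ∧
      ((Sm1 : Finset ι) : Set ι) ⊆ ω} := by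
    have hev : {ω : Set ι | (A'.filter fun z => ((P z : Finset ι) : Set ι) ⊆ ω).card = j ∧ ((Sm1 : Finset ι) : Set ι) ⊆ ω} =
        {ω : Set ι | (A'.filter fun z => ((P z : Finset ι) : Set ι) ⊆ ω).card = j} ∩ {ω | ((Sm1 : Finset ι) : Set ι) ⊆ ω} := by
      ext ω; simp
    have hdet : DeterminedBy {ω : Set ι | (A'.filter fun z => ((P z : Finset ι) : Set ι) ⊆ ω).card = j ∧
        ((Sm1 : Finset ι) : Set ι) ⊆ ω} (↑(univ.erase b) : Set ι) := by
      rw [hev]; exact ((dC fun c => c = j).inter (dS Sm1 (Finset.filter_subset _ _))).mono hGu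
    exact prodBernoulli_real_seriesSplit q q' hsb _ hdet hoff hq'sb
  -- Term B: four independent factors under `q'`
  set F : Finset ι := A'.biUnion fun z => P z \ P a with hF
  have hFS : Disjoint F (P a) := by rw [hF, Finset.disjoint_biUnion_left]; exact fun z _ => Finset.sdiff_disjoint
  have hbF : b ∉ F := by
    rw [hF, Finset.mem_biUnion]; rintro ⟨z, hz, h⟩; exact hbz hz (Finset.mem_sdiff.1 h).1
  have dD : DeterminedBy D (↑F : Set ι) :=
    determinedBy_card_filter_open _ (fun z => P z \ P a) F (fun z hz => Finset.subset_biUnion_of_mem (fun z => P z \ P a)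
      (Finset.mem_filter.1 hz).1) (fun c => c = j)
  have dmem : ∀ i : ι, DeterminedBy {ω : Set ι | i ∈ ω} (↑({i} : Finset ι) : Set ι) := fun i => by
    have := determinedBy_subset_open ({i} : Finset ι); simpa using this
  have dnot : DeterminedBy {ω : Set ι | s ∉ ω} (↑({s} : Finset ι) : Set ι) := by
    rw [determinedBy_iff]; intro ω ω' h
    have h1 : s ∈ ω ∩ ↑({s} : Finset ι) ↔ s ∈ ω' ∩ ↑({s} : Finset ι) := by rw [h]
    simp only [Set.mem_inter_iff, Finset.coe_singleton, Set.mem_singleton_iff, and_true] at h1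
    simp only [Set.mem_setOf_eq, h1]
  have p1 : μ'.real (D ∩ Om) = μ'.real D * μ'.real Om :=
    prodBernoulli_real_inter_of_determinedBy_disjoint q' (hFS.mono_right (Finset.filter_subset _ _)) dD
      (determinedBy_subset_open Sm) (hmeas _) (hmeas _)
  have hFSm_s : Disjoint (F ∪ Sm) {s} := by
    rw [Finset.disjoint_singleton_right, Finset.mem_union, not_or]
    exact ⟨fun h => Finset.disjoint_left.1 hFS h hs, hsSm⟩
  have p2 : μ'.real ((D ∩ Om) ∩ {ω | s ∉ ω}) = μ'.real (D ∩ Om) * μ'.real {ω | s ∉ ω} :=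
    prodBernoulli_real_inter_of_determinedBy_disjoint q' hFSm_s
      ((dD.mono (Finset.coe_subset.2 Finset.subset_union_left)).inter
        ((determinedBy_subset_open Sm).mono (Finset.coe_subset.2 Finset.subset_union_right))) dnot (hmeas _) (hmeas _)
  have hFSms_b : Disjoint (F ∪ Sm ∪ {s}) {b} := by
    rw [Finset.disjoint_singleton_right, Finset.mem_union, Finset.mem_union, not_or, not_or, Finset.mem_singleton]
    exact ⟨⟨hbF, hbSm⟩, Ne.symm hsb⟩
  have p3 : μ'.real PartB = μ'.real ((D ∩ Om) ∩ {ω | s ∉ ω}) * μ'.real {ω | b ∈ ω} :=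
    prodBernoulli_real_inter_of_determinedBy_disjoint q' hFSms_b
      ((((dD.mono (Finset.coe_subset.2 Finset.subset_union_left)).inter
        ((determinedBy_subset_open Sm).mono (Finset.coe_subset.2 Finset.subset_union_right))).mono
          (Finset.coe_subset.2 Finset.subset_union_left)).inter
        (dnot.mono (Finset.coe_subset.2 Finset.subset_union_right))) (dmem b) (hmeas _) (hmeas _)
  have hDq : μ'.real D = μ.real D :=
    prodBernoulli_real_eq_of_determinedBy q' q (fun i hi => hq' i (fun h => hbF (h ▸ Finset.mem_coe.1 hi))
      (fun h => Finset.disjoint_left.1 hFS (Finset.mem_coe.1 hi) (h ▸ hs))) dD (hmeas _)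
  have hOmq : μ'.real Om = ∏ y ∈ Sm, (q y : ℝ) := by
    rw [prodBernoulli_real_subset]
    exact Finset.prod_congr rfl fun y hy => by rw [hq' y (fun h => hbSm (h ▸ hy)) (fun h => hsSm (h ▸ hy))]
  have hsq : μ'.real {ω : Set ι | s ∉ ω} = 1 - q' s := prodBernoulli_real_setOf_notMem q' s
  have hbq : μ'.real {ω : Set ι | b ∈ ω} = q' b := prodBernoulli_real_setOf_mem q' b
  have hTB : μ'.real PartB = μ.real D * (∏ y ∈ Sm, (q y : ℝ)) * (1 - q' s) * q' b := by
    rw [p3, p2, p1, hDq, hOmq, hsq, hbq]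
  -- the level-`m+1` prefix product
  have hπ : ∏ y ∈ Sm1, (q y : ℝ) = (∏ y ∈ Sm, (q y : ℝ)) * q s := by
    rw [hSm1eq, Finset.prod_union (Finset.disjoint_singleton_right.2 hsSm), Finset.prod_singleton]
  -- assemble
  rw [hlight, measureReal_sdiff hsubL (hmeas _), measureReal_union hdisjAB (hmeas _), hT1, hTA, hTB, hπ, ← hq'sb]
  ring

end Quant

end Summit.CriticalPhenomena.PercolationContinuityZ3.Theorems

end
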